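import Mathlib
import HarnessLib
import Summits.HubbardSuperconductivity.HubbardSuperconductivity.Theorems.KLProgrammeH10TwoPointLimitSectorMultiplierJump

/-!
# Route `KLProgramme` — engine support, route (L2): WEIGHTED Young on the space-time torus and the weighted thin × thin character sums at a
# JUMP of scales from the neighbouring-scale bounds

Cell `gate-hubbard-kl`, seat p3 (g10); program «W2 = weighted overlap rows» (KL STATUS 2026-08-27 19:05Z), file W2d: the position-moment twin
of `Literature.…ProductTorusCharSumYoung.sum_norm_prodCharSum_mul_le` and of k3c2-p3's `…SectorMultiplierJump` (§2–§3).  The weight is the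
moment weight of the weighted rows, `w(z) = 1 + a|z̃₁| + b|z̃₂⁰| + b|z̃₂¹|` (`a, b ≥ 0`, centred representatives), written inline; it is
SUBMULTIPLICATIVE (`w(z) ≤ w(u)·w(z − u)`, `momentWt_le_mul_sub`), which is all Young's inequality needs:

* `abs_valMinAbs_add_le`, `momentWt_le_mul_sub`;
* **`sum_wt_norm_prodCharSum_mul_le`** — `Σ_z w(z)‖S_{G₁G₂}(z)‖ ≤ |G|⁻¹·(Σ_z w(z)‖S_{G₁}(z)‖)·(Σ_z w(z)‖S_{G₂}(z)‖)` on `(ℤ/P) × (ℤ/L)²`;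
* `sum_wt_norm_charSum_sum_le` — the weighted triangle inequality over a finite sum of symbols;
* **`charSumWt_klAniso_single_le`** (`≤ 27·T`), **`charSumWt_klAnisoPair_le_of_jump`** (`≤ 27(2ML²)⁻¹T₁T`),
  **`charSumWt_klAnisoPair_le_of_neighbouring`** (`≤ T + 729(2ML²)⁻¹T²`, uniform in the jump) — k3c2-p3's plateau-telescope statements with the
  weight `w` inside every `ℓ¹` norm.

Everything is proved; no definitions, no named facts. [cite: BenfattoGiulianiMastropietro2006, §2.7 (2.66), (2.71a), §2.8 (2.82)–(2.83)]
-/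

noncomputable section

namespace Summit.HubbardSuperconductivity.HubbardSuperconductivity.Theorems.TorusFourierL2

set_option linter.dupNamespace false -- summit = problem name (single-conjunct summit), D-0017

open Finset Literature.MathematicalPhysics.QuantumLattice Literature.Probability.LatticeModels
open Summit.HubbardSuperconductivity.HubbardSuperconductivity.Theorems.KLProgrammeLegKernels
open Summit.HubbardSuperconductivity.HubbardSuperconductivity.Theorems.KLRegimeSplit
open Summit.HubbardSuperconductivity.HubbardSuperconductivity.Theorems.EngineV8
open scoped ComplexConjugate

/-! ### §1 The moment weight is submultiplicative; weighted Young -/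

/-- `|(a + b)~| ≤ |ã| + |b̃|` for centred representatives in `ℤ/n`. [folklore] -/
theorem abs_valMinAbs_add_le {n : ℕ} [NeZero n] (a b : ZMod n) :
    |(((a + b).valMinAbs : ℤ) : ℝ)| ≤ |((a.valMinAbs : ℤ) : ℝ)| + |((b.valMinAbs : ℤ) : ℝ)| := by
  have h := (ZMod.natAbs_valMinAbs_add_le a b).trans (Int.natAbs_add_le _ _)
  have h' : (((a + b).valMinAbs.natAbs : ℕ) : ℝ) ≤ ((a.valMinAbs.natAbs : ℕ) : ℝ) + ((b.valMinAbs.natAbs : ℕ) : ℝ) := by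
    exact_mod_cast h
  simpa only [Nat.cast_natAbs, Int.cast_abs] using h'

section Wt

variable {P L : ℕ} [NeZero P] [NeZero L]

/-- **Submultiplicativity of the moment weight**: `w(z) ≤ w(u)·w(z − u)` for `w(z) = 1 + a|z̃₁| + b|z̃₂⁰| + b|z̃₂¹|`, `a, b ≥ 0`. [folklore] -/
theorem momentWt_le_mul_sub {a b : ℝ} (ha : 0 ≤ a) (hb : 0 ≤ b) (z u : TorusSite 1 P × TorusSite 2 L) :
    1 + a * |(((z.1 0).valMinAbs : ℤ) : ℝ)| + b * |(((z.2 0).valMinAbs : ℤ) : ℝ)| + b * |(((z.2 1).valMinAbs : ℤ) : ℝ)| ≤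
      (1 + a * |(((u.1 0).valMinAbs : ℤ) : ℝ)| + b * |(((u.2 0).valMinAbs : ℤ) : ℝ)| + b * |(((u.2 1).valMinAbs : ℤ) : ℝ)|) *
        (1 + a * |((((z - u).1 0).valMinAbs : ℤ) : ℝ)| + b * |((((z - u).2 0).valMinAbs : ℤ) : ℝ)| +
          b * |((((z - u).2 1).valMinAbs : ℤ) : ℝ)|) := by
  have e1 : z.1 0 = u.1 0 + (z - u).1 0 := by simp
  have e2 : ∀ j, z.2 j = u.2 j + (z - u).2 j := fun j => by simp
  have h1 : |(((z.1 0).valMinAbs : ℤ) : ℝ)| ≤ |(((u.1 0).valMinAbs : ℤ) : ℝ)| + |((((z - u).1 0).valMinAbs : ℤ) : ℝ)| := by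
    rw [e1]; exact abs_valMinAbs_add_le _ _
  have h2 : ∀ j, |(((z.2 j).valMinAbs : ℤ) : ℝ)| ≤ |(((u.2 j).valMinAbs : ℤ) : ℝ)| + |((((z - u).2 j).valMinAbs : ℤ) : ℝ)| :=
    fun j => by rw [e2 j]; exact abs_valMinAbs_add_le _ _
  set x₁ := |(((u.1 0).valMinAbs : ℤ) : ℝ)|
  set x₂ := |(((u.2 0).valMinAbs : ℤ) : ℝ)|
  set x₃ := |(((u.2 1).valMinAbs : ℤ) : ℝ)|
  set y₁ := |((((z - u).1 0).valMinAbs : ℤ) : ℝ)|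
  set y₂ := |((((z - u).2 0).valMinAbs : ℤ) : ℝ)|
  set y₃ := |((((z - u).2 1).valMinAbs : ℤ) : ℝ)|
  have hx₁ : 0 ≤ x₁ := abs_nonneg _
  have hx₂ : 0 ≤ x₂ := abs_nonneg _
  have hx₃ : 0 ≤ x₃ := abs_nonneg _
  have hy₁ : 0 ≤ y₁ := abs_nonneg _
  have hy₂ : 0 ≤ y₂ := abs_nonneg _
  have hy₃ : 0 ≤ y₃ := abs_nonneg _
  have hX : 0 ≤ a * x₁ + b * x₂ + b * x₃ := by positivity
  have hY : 0 ≤ a * y₁ + b * y₂ + b * y₃ := by positivity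
  calc 1 + a * |(((z.1 0).valMinAbs : ℤ) : ℝ)| + b * |(((z.2 0).valMinAbs : ℤ) : ℝ)| + b * |(((z.2 1).valMinAbs : ℤ) : ℝ)|
      ≤ 1 + a * (x₁ + y₁) + b * (x₂ + y₂) + b * (x₃ + y₃) := by
        have := h2 0; have := h2 1; gcongr
    _ = 1 + (a * x₁ + b * x₂ + b * x₃) + (a * y₁ + b * y₂ + b * y₃) := by ring
    _ ≤ (1 + (a * x₁ + b * x₂ + b * x₃)) * (1 + (a * y₁ + b * y₂ + b * y₃)) := by nlinarith [mul_nonneg hX hY]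
    _ = _ := by ring

/-- **Weighted Young on the space-time torus** `(ℤ/P) × (ℤ/L)²`: for the submultiplicative moment weight `w`,
`Σ_z w(z)‖S_{G₁G₂}(z)‖ ≤ (P·L²)⁻¹·(Σ_z w(z)‖S_{G₁}(z)‖)·(Σ_z w(z)‖S_{G₂}(z)‖)`. [cite: BenfattoGiulianiMastropietro2006, §2.7 (2.71a)] -/
theorem sum_wt_norm_prodCharSum_mul_le {a b : ℝ} (ha : 0 ≤ a) (hb : 0 ≤ b) (G₁ G₂ : TorusSite 1 P × TorusSite 2 L → ℂ) :
    ∑ z : TorusSite 1 P × TorusSite 2 L,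
        (1 + a * |(((z.1 0).valMinAbs : ℤ) : ℝ)| + b * |(((z.2 0).valMinAbs : ℤ) : ℝ)| + b * |(((z.2 1).valMinAbs : ℤ) : ℝ)|) *
          ‖∑ q : TorusSite 1 P × TorusSite 2 L, (torusChar q.1 z.1 * torusChar q.2 z.2) • (G₁ q * G₂ q)‖ ≤
      (((P : ℝ) ^ 1 * (L : ℝ) ^ 2))⁻¹ *
        ((∑ z : TorusSite 1 P × TorusSite 2 L,
            (1 + a * |(((z.1 0).valMinAbs : ℤ) : ℝ)| + b * |(((z.2 0).valMinAbs : ℤ) : ℝ)| + b * |(((z.2 1).valMinAbs : ℤ) : ℝ)|) *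
              ‖∑ q : TorusSite 1 P × TorusSite 2 L, (torusChar q.1 z.1 * torusChar q.2 z.2) • G₁ q‖) *
          ∑ z : TorusSite 1 P × TorusSite 2 L,
            (1 + a * |(((z.1 0).valMinAbs : ℤ) : ℝ)| + b * |(((z.2 0).valMinAbs : ℤ) : ℝ)| + b * |(((z.2 1).valMinAbs : ℤ) : ℝ)|) *
              ‖∑ q : TorusSite 1 P × TorusSite 2 L, (torusChar q.1 z.1 * torusChar q.2 z.2) • G₂ q‖) := by
  -- abbreviations
  set w : TorusSite 1 P × TorusSite 2 L → ℝ := fun z =>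
    1 + a * |(((z.1 0).valMinAbs : ℤ) : ℝ)| + b * |(((z.2 0).valMinAbs : ℤ) : ℝ)| + b * |(((z.2 1).valMinAbs : ℤ) : ℝ)| with hw
  set S₁ : TorusSite 1 P × TorusSite 2 L → ℂ := fun z =>
    ∑ q : TorusSite 1 P × TorusSite 2 L, (torusChar q.1 z.1 * torusChar q.2 z.2) • G₁ q with hS₁
  set S₂ : TorusSite 1 P × TorusSite 2 L → ℂ := fun z =>
    ∑ q : TorusSite 1 P × TorusSite 2 L, (torusChar q.1 z.1 * torusChar q.2 z.2) • G₂ q with hS₂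
  have hw0 : ∀ z, 0 ≤ w z := fun z => by rw [hw]; positivity
  have hwsub : ∀ z u, w z ≤ w u * w (z - u) := fun z u => momentWt_le_mul_sub ha hb z u
  have hcR : (0 : ℝ) < (P : ℝ) ^ 1 * (L : ℝ) ^ 2 := by
    have h1 : (0 : ℝ) < P := Nat.cast_pos.2 (Nat.pos_of_ne_zero (NeZero.ne P))
    have h2 : (0 : ℝ) < L := Nat.cast_pos.2 (Nat.pos_of_ne_zero (NeZero.ne L))
    positivity
  have hcC : ((P : ℂ) ^ 1 * (L : ℂ) ^ 2) ≠ 0 := mul_ne_zero natCast_pow_ne_zero natCast_pow_ne_zero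
  have hnc : ‖((P : ℂ) ^ 1 * (L : ℂ) ^ 2)‖ = (P : ℝ) ^ 1 * (L : ℝ) ^ 2 := by
    rw [norm_mul, norm_pow, norm_pow, Complex.norm_natCast, Complex.norm_natCast]
  -- pointwise: `w(z)‖S₁₂(z)‖ ≤ |G|⁻¹ Σ_u (w u ‖S₂ u‖)(w (z-u) ‖S₁ (z - u)‖)`
  have hpt : ∀ z : TorusSite 1 P × TorusSite 2 L,
      w z * ‖∑ q : TorusSite 1 P × TorusSite 2 L, (torusChar q.1 z.1 * torusChar q.2 z.2) • (G₁ q * G₂ q)‖ ≤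
        ((P : ℝ) ^ 1 * (L : ℝ) ^ 2)⁻¹ * ∑ u : TorusSite 1 P × TorusSite 2 L, (w u * ‖S₂ u‖) * (w (z - u) * ‖S₁ (z - u)‖) := by
    intro z
    have heq : ∑ q : TorusSite 1 P × TorusSite 2 L, (torusChar q.1 z.1 * torusChar q.2 z.2) • (G₁ q * G₂ q) =
        ((P : ℂ) ^ 1 * (L : ℂ) ^ 2)⁻¹ * ∑ u : TorusSite 1 P × TorusSite 2 L, S₂ u * S₁ (z - u) := by
      rw [← prodCharSum_mul_eq_conv G₁ G₂ z, ← mul_assoc, inv_mul_cancel₀ hcC, one_mul]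
    rw [heq, norm_mul, norm_inv, hnc, ← mul_assoc, mul_comm (w z), mul_assoc]
    refine mul_le_mul_of_nonneg_left ?_ (inv_nonneg.2 hcR.le)
    calc w z * ‖∑ u : TorusSite 1 P × TorusSite 2 L, S₂ u * S₁ (z - u)‖
        ≤ w z * ∑ u : TorusSite 1 P × TorusSite 2 L, ‖S₂ u‖ * ‖S₁ (z - u)‖ :=
          mul_le_mul_of_nonneg_left ((norm_sum_le _ _).trans (le_of_eq (sum_congr rfl fun u _ => norm_mul _ _))) (hw0 z)
      _ = ∑ u : TorusSite 1 P × TorusSite 2 L, w z * (‖S₂ u‖ * ‖S₁ (z - u)‖) := by rw [mul_sum]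
      _ ≤ ∑ u : TorusSite 1 P × TorusSite 2 L, (w u * w (z - u)) * (‖S₂ u‖ * ‖S₁ (z - u)‖) :=
          sum_le_sum fun u _ => mul_le_mul_of_nonneg_right (hwsub z u) (by positivity)
      _ = _ := sum_congr rfl fun u _ => by ring
  calc ∑ z : TorusSite 1 P × TorusSite 2 L,
        w z * ‖∑ q : TorusSite 1 P × TorusSite 2 L, (torusChar q.1 z.1 * torusChar q.2 z.2) • (G₁ q * G₂ q)‖
      ≤ ∑ z : TorusSite 1 P × TorusSite 2 L, ((P : ℝ) ^ 1 * (L : ℝ) ^ 2)⁻¹ *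
          ∑ u : TorusSite 1 P × TorusSite 2 L, (w u * ‖S₂ u‖) * (w (z - u) * ‖S₁ (z - u)‖) := sum_le_sum fun z _ => hpt z
    _ = ((P : ℝ) ^ 1 * (L : ℝ) ^ 2)⁻¹ * ∑ u : TorusSite 1 P × TorusSite 2 L,
          (w u * ‖S₂ u‖) * ∑ z : TorusSite 1 P × TorusSite 2 L, w (z - u) * ‖S₁ (z - u)‖ := by
        rw [← mul_sum, Finset.sum_comm]
        exact congrArg _ (sum_congr rfl fun u _ => by rw [mul_sum])
    _ = ((P : ℝ) ^ 1 * (L : ℝ) ^ 2)⁻¹ * ∑ u : TorusSite 1 P × TorusSite 2 L,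
          (w u * ‖S₂ u‖) * ∑ z : TorusSite 1 P × TorusSite 2 L, w z * ‖S₁ z‖ := by
        refine congrArg _ (sum_congr rfl fun u _ => congrArg _ ?_)
        exact Fintype.sum_equiv (Equiv.subRight u) _ _ fun z => rfl
    _ = _ := by rw [← sum_mul, mul_comm (∑ u : TorusSite 1 P × TorusSite 2 L, _)]

/-- **Weighted triangle inequality over a finite sum of symbols**: `Σ_z w(z)‖S_{Σᵢ Gᵢ}(z)‖ ≤ Σᵢ Σ_z w(z)‖S_{Gᵢ}(z)‖` for any `w ≥ 0`. [folklore] -/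
theorem sum_wt_norm_charSum_sum_le {ι : Type*} (s : Finset ι) (w : TorusSite 1 P × TorusSite 2 L → ℝ) (hw : ∀ z, 0 ≤ w z)
    (G : ι → TorusSite 1 P × TorusSite 2 L → ℂ) :
    ∑ z : TorusSite 1 P × TorusSite 2 L,
        w z * ‖∑ q : TorusSite 1 P × TorusSite 2 L, (torusChar q.1 z.1 * torusChar q.2 z.2) • ∑ i ∈ s, G i q‖ ≤
      ∑ i ∈ s, ∑ z : TorusSite 1 P × TorusSite 2 L,
        w z * ‖∑ q : TorusSite 1 P × TorusSite 2 L, (torusChar q.1 z.1 * torusChar q.2 z.2) • G i q‖ := by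
  rw [Finset.sum_comm]
  refine Finset.sum_le_sum fun z _ => ?_
  have e : ∑ q : TorusSite 1 P × TorusSite 2 L, (torusChar q.1 z.1 * torusChar q.2 z.2) • ∑ i ∈ s, G i q =
      ∑ i ∈ s, ∑ q : TorusSite 1 P × TorusSite 2 L, (torusChar q.1 z.1 * torusChar q.2 z.2) • G i q := by
    simp_rw [Finset.smul_sum]
    rw [Finset.sum_comm]
  rw [e, ← mul_sum]
  exact mul_le_mul_of_nonneg_left (norm_sum_le _ _) (hw z)

end Wt

/-! ### §2 The weighted thin × thin character sums: single from pairs, the jump, jump-uniformity -/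

section Thin

open Classical

variable {L M : ℕ} [NeZero L] [NeZero M]

/-- **The weighted single-multiplier character sum from the neighbouring pairs**: for `n ≥ 1`, if every product `F_{n,ω}·F_{n−1,a'}` has weighted
`ℓ¹` character sum `≤ T`, then the weighted `ℓ¹` character sum of `F_{n,ω}` is `≤ 27·T` (`a, b ≥ 0`).
[cite: BenfattoGiulianiMastropietro2006, §2.7 (2.66)] -/
theorem charSumWt_klAniso_single_le (β μ : ℝ) (K : TrigPolyC4v) {a b : ℝ} (ha : 0 ≤ a) (hb : 0 ≤ b) {n : ℕ} (hn : 1 ≤ n)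
    (ω : Fin (sectorCount n)) {T : ℝ} (hT0 : 0 ≤ T)
    (hT : ∀ a' : Fin (sectorCount (n - 1)), ∑ z : TorusSite 1 (2 * M) × TorusSite 2 L,
      (1 + a * |(((z.1 0).valMinAbs : ℤ) : ℝ)| + b * |(((z.2 0).valMinAbs : ℤ) : ℝ)| + b * |(((z.2 1).valMinAbs : ℤ) : ℝ)|) *
      ‖∑ q : TorusSite 1 (2 * M) × TorusSite 2 L, (torusChar q.1 z.1 * torusChar q.2 z.2) •
        (klAnisoFamily L M β μ K klE0 n ω (⟨(q.1 0).val, ZMod.val_lt (q.1 0)⟩, q.2) *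
          klAnisoFamily L M β μ K klE0 (n - 1) a' (⟨(q.1 0).val, ZMod.val_lt (q.1 0)⟩, q.2))‖ ≤ T) :
    ∑ z : TorusSite 1 (2 * M) × TorusSite 2 L,
      (1 + a * |(((z.1 0).valMinAbs : ℤ) : ℝ)| + b * |(((z.2 0).valMinAbs : ℤ) : ℝ)| + b * |(((z.2 1).valMinAbs : ℤ) : ℝ)|) *
      ‖∑ q : TorusSite 1 (2 * M) × TorusSite 2 L, (torusChar q.1 z.1 * torusChar q.2 z.2) •
        klAnisoFamily L M β μ K klE0 n ω (⟨(q.1 0).val, ZMod.val_lt (q.1 0)⟩, q.2)‖ ≤ 27 * T := by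
  have he : (0 : ℝ) < klE0 := by norm_num [klE0]
  have hj : (n - 1) + 1 ≤ n := by omega
  set S := (univ : Finset (Fin (sectorCount (n - 1)))).filter (fun a' : Fin (sectorCount (n - 1)) =>
      ∃ q : FreqMomentum L M, klAnisoFamily L M β μ K klE0 n ω q ≠ 0 ∧
        bgmFatMultiplier L M klE0 β (nambuXiCT L μ K) (n - 1) a' q ≠ 0) with hS
  have hScard : S.card ≤ 27 := card_overlap_klAniso_bgmFat_coarse_le he β μ K (by omega) ω
  have htel : ∀ q : TorusSite 1 (2 * M) × TorusSite 2 L,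
      klAnisoFamily L M β μ K klE0 n ω (⟨(q.1 0).val, ZMod.val_lt (q.1 0)⟩, q.2) =
        ∑ a' ∈ S, klAnisoFamily L M β μ K klE0 n ω (⟨(q.1 0).val, ZMod.val_lt (q.1 0)⟩, q.2) *
          klAnisoFamily L M β μ K klE0 (n - 1) a' (⟨(q.1 0).val, ZMod.val_lt (q.1 0)⟩, q.2) :=
    fun q => klAnisoFamily_eq_sum_mul_of_succ_le β μ K hj ω _
  have hw0 : ∀ z : TorusSite 1 (2 * M) × TorusSite 2 L,
      0 ≤ 1 + a * |(((z.1 0).valMinAbs : ℤ) : ℝ)| + b * |(((z.2 0).valMinAbs : ℤ) : ℝ)| + b * |(((z.2 1).valMinAbs : ℤ) : ℝ)| :=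
    fun z => by positivity
  rw [show (∑ z : TorusSite 1 (2 * M) × TorusSite 2 L,
      (1 + a * |(((z.1 0).valMinAbs : ℤ) : ℝ)| + b * |(((z.2 0).valMinAbs : ℤ) : ℝ)| + b * |(((z.2 1).valMinAbs : ℤ) : ℝ)|) *
      ‖∑ q : TorusSite 1 (2 * M) × TorusSite 2 L, (torusChar q.1 z.1 * torusChar q.2 z.2) •
        klAnisoFamily L M β μ K klE0 n ω (⟨(q.1 0).val, ZMod.val_lt (q.1 0)⟩, q.2)‖) =
      ∑ z : TorusSite 1 (2 * M) × TorusSite 2 L,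
        (1 + a * |(((z.1 0).valMinAbs : ℤ) : ℝ)| + b * |(((z.2 0).valMinAbs : ℤ) : ℝ)| + b * |(((z.2 1).valMinAbs : ℤ) : ℝ)|) *
        ‖∑ q : TorusSite 1 (2 * M) × TorusSite 2 L, (torusChar q.1 z.1 * torusChar q.2 z.2) •
          ∑ a' ∈ S, klAnisoFamily L M β μ K klE0 n ω (⟨(q.1 0).val, ZMod.val_lt (q.1 0)⟩, q.2) *
            klAnisoFamily L M β μ K klE0 (n - 1) a' (⟨(q.1 0).val, ZMod.val_lt (q.1 0)⟩, q.2)‖ from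
    sum_congr rfl fun z _ => congrArg _ (congrArg _ (sum_congr rfl fun q _ => congrArg _ (htel q)))]
  refine (sum_wt_norm_charSum_sum_le S _ hw0 _).trans ?_
  calc _ ≤ ∑ _a ∈ S, T := sum_le_sum fun a' _ => hT a'
    _ = S.card * T := by rw [sum_const, nsmul_eq_mul]
    _ ≤ 27 * T := mul_le_mul_of_nonneg_right (by exact_mod_cast hScard) hT0

/-- **Weighted thin × thin at a jump `n₂ + 2 ≤ n₁`**: `≤ 27·(2M·L²)⁻¹·(T₁·T)` with `T₁` the weighted single bound of `F_{n₁,ω₁}` and `T` the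
weighted neighbouring pair bound at `(n₂+1, n₂)` — plateau telescope and WEIGHTED Young. [cite: BenfattoGiulianiMastropietro2006, §2.7 (2.71a), §2.8 (2.82)] -/
theorem charSumWt_klAnisoPair_le_of_jump (β μ : ℝ) (K : TrigPolyC4v) {a b : ℝ} (ha : 0 ≤ a) (hb : 0 ≤ b) {n₁ n₂ : ℕ} (hn : n₂ + 2 ≤ n₁)
    (ω₁ : Fin (sectorCount n₁)) (a₂ : Fin (sectorCount n₂)) {T₁ T : ℝ} (hT₁0 : 0 ≤ T₁) (hT0 : 0 ≤ T)
    (hT₁ : ∑ z : TorusSite 1 (2 * M) × TorusSite 2 L,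
      (1 + a * |(((z.1 0).valMinAbs : ℤ) : ℝ)| + b * |(((z.2 0).valMinAbs : ℤ) : ℝ)| + b * |(((z.2 1).valMinAbs : ℤ) : ℝ)|) *
      ‖∑ q : TorusSite 1 (2 * M) × TorusSite 2 L, (torusChar q.1 z.1 * torusChar q.2 z.2) •
        klAnisoFamily L M β μ K klE0 n₁ ω₁ (⟨(q.1 0).val, ZMod.val_lt (q.1 0)⟩, q.2)‖ ≤ T₁)
    (hT : ∀ b' : Fin (sectorCount (n₂ + 1)), ∑ z : TorusSite 1 (2 * M) × TorusSite 2 L,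
      (1 + a * |(((z.1 0).valMinAbs : ℤ) : ℝ)| + b * |(((z.2 0).valMinAbs : ℤ) : ℝ)| + b * |(((z.2 1).valMinAbs : ℤ) : ℝ)|) *
      ‖∑ q : TorusSite 1 (2 * M) × TorusSite 2 L, (torusChar q.1 z.1 * torusChar q.2 z.2) •
        (klAnisoFamily L M β μ K klE0 (n₂ + 1) b' (⟨(q.1 0).val, ZMod.val_lt (q.1 0)⟩, q.2) *
          klAnisoFamily L M β μ K klE0 n₂ a₂ (⟨(q.1 0).val, ZMod.val_lt (q.1 0)⟩, q.2))‖ ≤ T) :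
    ∑ z : TorusSite 1 (2 * M) × TorusSite 2 L,
      (1 + a * |(((z.1 0).valMinAbs : ℤ) : ℝ)| + b * |(((z.2 0).valMinAbs : ℤ) : ℝ)| + b * |(((z.2 1).valMinAbs : ℤ) : ℝ)|) *
      ‖∑ q : TorusSite 1 (2 * M) × TorusSite 2 L, (torusChar q.1 z.1 * torusChar q.2 z.2) •
        (klAnisoFamily L M β μ K klE0 n₁ ω₁ (⟨(q.1 0).val, ZMod.val_lt (q.1 0)⟩, q.2) *
          klAnisoFamily L M β μ K klE0 n₂ a₂ (⟨(q.1 0).val, ZMod.val_lt (q.1 0)⟩, q.2))‖ ≤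
      27 * ((((2 * M : ℕ) : ℝ) ^ 1 * (L : ℝ) ^ 2)⁻¹ * (T₁ * T)) := by
  have he : (0 : ℝ) < klE0 := by norm_num [klE0]
  have hj : (n₂ + 1) + 1 ≤ n₁ := by omega
  set S := (univ : Finset (Fin (sectorCount (n₂ + 1)))).filter (fun b' : Fin (sectorCount (n₂ + 1)) =>
      ∃ q : FreqMomentum L M, klAnisoFamily L M β μ K klE0 n₁ ω₁ q ≠ 0 ∧
        bgmFatMultiplier L M klE0 β (nambuXiCT L μ K) (n₂ + 1) b' q ≠ 0) with hS
  have hScard : S.card ≤ 27 := card_overlap_klAniso_bgmFat_coarse_le he β μ K (by omega) ω₁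
  have hw0 : ∀ z : TorusSite 1 (2 * M) × TorusSite 2 L,
      0 ≤ 1 + a * |(((z.1 0).valMinAbs : ℤ) : ℝ)| + b * |(((z.2 0).valMinAbs : ℤ) : ℝ)| + b * |(((z.2 1).valMinAbs : ℤ) : ℝ)| :=
    fun z => by positivity
  have htel : ∀ q : TorusSite 1 (2 * M) × TorusSite 2 L,
      klAnisoFamily L M β μ K klE0 n₁ ω₁ (⟨(q.1 0).val, ZMod.val_lt (q.1 0)⟩, q.2) *
          klAnisoFamily L M β μ K klE0 n₂ a₂ (⟨(q.1 0).val, ZMod.val_lt (q.1 0)⟩, q.2) =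
        ∑ b' ∈ S, klAnisoFamily L M β μ K klE0 n₁ ω₁ (⟨(q.1 0).val, ZMod.val_lt (q.1 0)⟩, q.2) *
          (klAnisoFamily L M β μ K klE0 (n₂ + 1) b' (⟨(q.1 0).val, ZMod.val_lt (q.1 0)⟩, q.2) *
            klAnisoFamily L M β μ K klE0 n₂ a₂ (⟨(q.1 0).val, ZMod.val_lt (q.1 0)⟩, q.2)) := by
    intro q
    rw [sum_congr rfl fun b' _ => (mul_assoc _ _ _).symm, ← sum_mul, ← klAnisoFamily_eq_sum_mul_of_succ_le β μ K hj ω₁ _]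
  rw [show (∑ z : TorusSite 1 (2 * M) × TorusSite 2 L,
      (1 + a * |(((z.1 0).valMinAbs : ℤ) : ℝ)| + b * |(((z.2 0).valMinAbs : ℤ) : ℝ)| + b * |(((z.2 1).valMinAbs : ℤ) : ℝ)|) *
      ‖∑ q : TorusSite 1 (2 * M) × TorusSite 2 L, (torusChar q.1 z.1 * torusChar q.2 z.2) •
        (klAnisoFamily L M β μ K klE0 n₁ ω₁ (⟨(q.1 0).val, ZMod.val_lt (q.1 0)⟩, q.2) *
          klAnisoFamily L M β μ K klE0 n₂ a₂ (⟨(q.1 0).val, ZMod.val_lt (q.1 0)⟩, q.2))‖) =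
      ∑ z : TorusSite 1 (2 * M) × TorusSite 2 L,
        (1 + a * |(((z.1 0).valMinAbs : ℤ) : ℝ)| + b * |(((z.2 0).valMinAbs : ℤ) : ℝ)| + b * |(((z.2 1).valMinAbs : ℤ) : ℝ)|) *
        ‖∑ q : TorusSite 1 (2 * M) × TorusSite 2 L, (torusChar q.1 z.1 * torusChar q.2 z.2) •
          ∑ b' ∈ S, klAnisoFamily L M β μ K klE0 n₁ ω₁ (⟨(q.1 0).val, ZMod.val_lt (q.1 0)⟩, q.2) *
            (klAnisoFamily L M β μ K klE0 (n₂ + 1) b' (⟨(q.1 0).val, ZMod.val_lt (q.1 0)⟩, q.2) *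
              klAnisoFamily L M β μ K klE0 n₂ a₂ (⟨(q.1 0).val, ZMod.val_lt (q.1 0)⟩, q.2))‖ from
    sum_congr rfl fun z _ => congrArg _ (congrArg _ (sum_congr rfl fun q _ => congrArg _ (htel q)))]
  refine (sum_wt_norm_charSum_sum_le S _ hw0 _).trans ?_
  have hG : (0 : ℝ) < (((2 * M : ℕ) : ℝ) ^ 1 * (L : ℝ) ^ 2) := by
    have h1 : (0 : ℝ) < ((2 * M : ℕ) : ℝ) := Nat.cast_pos.2 (Nat.pos_of_ne_zero (NeZero.ne (2 * M)))
    have h2 : (0 : ℝ) < L := Nat.cast_pos.2 (Nat.pos_of_ne_zero (NeZero.ne L))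
    positivity
  have hterm : ∀ b' ∈ S, ∑ z : TorusSite 1 (2 * M) × TorusSite 2 L,
      (1 + a * |(((z.1 0).valMinAbs : ℤ) : ℝ)| + b * |(((z.2 0).valMinAbs : ℤ) : ℝ)| + b * |(((z.2 1).valMinAbs : ℤ) : ℝ)|) *
      ‖∑ q : TorusSite 1 (2 * M) × TorusSite 2 L, (torusChar q.1 z.1 * torusChar q.2 z.2) •
        (klAnisoFamily L M β μ K klE0 n₁ ω₁ (⟨(q.1 0).val, ZMod.val_lt (q.1 0)⟩, q.2) *
          (klAnisoFamily L M β μ K klE0 (n₂ + 1) b' (⟨(q.1 0).val, ZMod.val_lt (q.1 0)⟩, q.2) *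
            klAnisoFamily L M β μ K klE0 n₂ a₂ (⟨(q.1 0).val, ZMod.val_lt (q.1 0)⟩, q.2)))‖ ≤
      (((2 * M : ℕ) : ℝ) ^ 1 * (L : ℝ) ^ 2)⁻¹ * (T₁ * T) := by
    intro b' _
    refine (sum_wt_norm_prodCharSum_mul_le (P := 2 * M) (L := L) ha hb _ _).trans ?_
    refine mul_le_mul_of_nonneg_left (mul_le_mul hT₁ (hT b') (sum_nonneg fun z _ => ?_) hT₁0) (inv_nonneg.2 hG.le)
    exact mul_nonneg (hw0 z) (norm_nonneg _)
  calc _ ≤ ∑ _b ∈ S, (((2 * M : ℕ) : ℝ) ^ 1 * (L : ℝ) ^ 2)⁻¹ * (T₁ * T) := sum_le_sum hterm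
    _ = S.card * ((((2 * M : ℕ) : ℝ) ^ 1 * (L : ℝ) ^ 2)⁻¹ * (T₁ * T)) := by rw [sum_const, nsmul_eq_mul]
    _ ≤ 27 * ((((2 * M : ℕ) : ℝ) ^ 1 * (L : ℝ) ^ 2)⁻¹ * (T₁ * T)) :=
        mul_le_mul_of_nonneg_right (by exact_mod_cast hScard) (by positivity)

/-- **Jump-uniform weighted thin × thin character sums from a uniform weighted neighbouring bound**: if for every scale `1 ≤ n ≤ N` every
neighbouring product has weighted `ℓ¹` character sum `≤ T`, then for all `n₂ + 1 ≤ n₁ ≤ N` and all sectors the weighted `ℓ¹` character sum of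
`F_{n₁,ω₁}F_{n₂,a'}` is `≤ T + 729·(2M·L²)⁻¹·T²`. [cite: BenfattoGiulianiMastropietro2006, §2.8 (2.82)–(2.83)] -/
theorem charSumWt_klAnisoPair_le_of_neighbouring (β μ : ℝ) (K : TrigPolyC4v) {a b : ℝ} (ha : 0 ≤ a) (hb : 0 ≤ b) {N : ℕ} {T : ℝ}
    (hT0 : 0 ≤ T)
    (hT : ∀ n : ℕ, 1 ≤ n → n ≤ N → ∀ (ω : Fin (sectorCount n)) (a' : Fin (sectorCount (n - 1))),
      ∑ z : TorusSite 1 (2 * M) × TorusSite 2 L,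
        (1 + a * |(((z.1 0).valMinAbs : ℤ) : ℝ)| + b * |(((z.2 0).valMinAbs : ℤ) : ℝ)| + b * |(((z.2 1).valMinAbs : ℤ) : ℝ)|) *
        ‖∑ q : TorusSite 1 (2 * M) × TorusSite 2 L, (torusChar q.1 z.1 * torusChar q.2 z.2) •
          (klAnisoFamily L M β μ K klE0 n ω (⟨(q.1 0).val, ZMod.val_lt (q.1 0)⟩, q.2) *
            klAnisoFamily L M β μ K klE0 (n - 1) a' (⟨(q.1 0).val, ZMod.val_lt (q.1 0)⟩, q.2))‖ ≤ T)
    {n₁ n₂ : ℕ} (hn : n₂ + 1 ≤ n₁) (hN : n₁ ≤ N) (ω₁ : Fin (sectorCount n₁)) (a₂ : Fin (sectorCount n₂)) :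
    ∑ z : TorusSite 1 (2 * M) × TorusSite 2 L,
      (1 + a * |(((z.1 0).valMinAbs : ℤ) : ℝ)| + b * |(((z.2 0).valMinAbs : ℤ) : ℝ)| + b * |(((z.2 1).valMinAbs : ℤ) : ℝ)|) *
      ‖∑ q : TorusSite 1 (2 * M) × TorusSite 2 L, (torusChar q.1 z.1 * torusChar q.2 z.2) •
        (klAnisoFamily L M β μ K klE0 n₁ ω₁ (⟨(q.1 0).val, ZMod.val_lt (q.1 0)⟩, q.2) *
          klAnisoFamily L M β μ K klE0 n₂ a₂ (⟨(q.1 0).val, ZMod.val_lt (q.1 0)⟩, q.2))‖ ≤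
      T + 729 * ((((2 * M : ℕ) : ℝ) ^ 1 * (L : ℝ) ^ 2)⁻¹ * T ^ 2) := by
  have hG : (0 : ℝ) < (((2 * M : ℕ) : ℝ) ^ 1 * (L : ℝ) ^ 2) := by
    have h1 : (0 : ℝ) < ((2 * M : ℕ) : ℝ) := Nat.cast_pos.2 (Nat.pos_of_ne_zero (NeZero.ne (2 * M)))
    have h2 : (0 : ℝ) < L := Nat.cast_pos.2 (Nat.pos_of_ne_zero (NeZero.ne L))
    positivity
  have hextra : 0 ≤ 729 * ((((2 * M : ℕ) : ℝ) ^ 1 * (L : ℝ) ^ 2)⁻¹ * T ^ 2) := by positivity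
  rcases Nat.lt_or_ge (n₂ + 1) n₁ with hlt | hge
  · have hn2 : n₂ + 2 ≤ n₁ := hlt
    have hT₁ := charSumWt_klAniso_single_le (L := L) (M := M) β μ K ha hb (n := n₁) (by omega) ω₁ hT0
      (fun a' => hT n₁ (by omega) hN ω₁ a')
    have hnb : ∀ b' : Fin (sectorCount (n₂ + 1)), ∑ z : TorusSite 1 (2 * M) × TorusSite 2 L,
        (1 + a * |(((z.1 0).valMinAbs : ℤ) : ℝ)| + b * |(((z.2 0).valMinAbs : ℤ) : ℝ)| + b * |(((z.2 1).valMinAbs : ℤ) : ℝ)|) *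
        ‖∑ q : TorusSite 1 (2 * M) × TorusSite 2 L, (torusChar q.1 z.1 * torusChar q.2 z.2) •
          (klAnisoFamily L M β μ K klE0 (n₂ + 1) b' (⟨(q.1 0).val, ZMod.val_lt (q.1 0)⟩, q.2) *
            klAnisoFamily L M β μ K klE0 n₂ a₂ (⟨(q.1 0).val, ZMod.val_lt (q.1 0)⟩, q.2))‖ ≤ T := by
      intro b'
      exact hT (n₂ + 1) (by omega) (by omega) b' a₂
    refine (charSumWt_klAnisoPair_le_of_jump β μ K ha hb hn2 ω₁ a₂ (by positivity) hT0 hT₁ hnb).trans ?_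
    calc 27 * ((((2 * M : ℕ) : ℝ) ^ 1 * (L : ℝ) ^ 2)⁻¹ * (27 * T * T))
        = 729 * ((((2 * M : ℕ) : ℝ) ^ 1 * (L : ℝ) ^ 2)⁻¹ * T ^ 2) := by ring
      _ ≤ T + 729 * ((((2 * M : ℕ) : ℝ) ^ 1 * (L : ℝ) ^ 2)⁻¹ * T ^ 2) := le_add_of_nonneg_left hT0
  · have heq : n₁ = n₂ + 1 := le_antisymm hge hn
    subst heq
    exact (hT (n₂ + 1) (by omega) hN ω₁ a₂).trans (le_add_of_nonneg_right hextra)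

end Thin

end Summit.HubbardSuperconductivity.HubbardSuperconductivity.Theorems.TorusFourierL2

end
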